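import Mathlib
import HarnessLib
import Summits.RiemannHypothesis.RiemannHypothesis.Theorems.IntegerScrewWalkLevelsAlgebra
import Summits.RiemannHypothesis.RiemannHypothesis.Theorems.IntegerScrewParityGram
import Summits.RiemannHypothesis.RiemannHypothesis.Theorems.IntegerScrewParityLeibniz

/-!
# Route `IntegerScrew` — ALL RUNGS: for every finite family `𝒮` of non-empty finite sets of primes, on
# `span{1, φ_S : S ∈ 𝒮}` (`φ_S = Π_{p∈S}φ_p`) the truncated multiplicative walk has `E(g) ≤ ((Λ+η)/L)‖g‖²_π` once
# `log M ≥ m·|𝒮|·(Λ+1)(B²+B+1)/η` (`λ_S = Σ_{p∈S}λ_p ≤ Λ`, `Π_{p∈S}p² ≤ m`, `2^{|S∪S'|} ≤ B` on `𝒮`) — by min–max,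
# `−ℒ_M` has at least `|𝒮|` eigenvalues `≤ Λ + η` in `t`-units: every initial segment of the prime-parity LADDER
# `{λ_S}` of PIVOT-LAW 13.10 (iv) / CONTINUUM-LIMIT 23.18, composite rungs included

The scheme of `IntegerScrewWalkLevels.walk_levels` with the composite inputs: exact eigen-relations
`ℒ_Mφ_S = −λ_Sφ_S + Σ_{r∈S}φ_{S∖r}𝟙[r∤x]r_r` (`IntegerScrewParityLeibniz.walkGen_parity_prod_eq`), Gram entries
`‖φ_S‖² ≥ H_M/Π_S p²`, `|⟨φ_S,φ_{S'}⟩| ≤ 2^{|S∪S'|}` (`S ≠ S'`), `|π(φ_S)| ≤ 2^{|S|}` (`IntegerScrewParityGram`),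
defect mass `Σ_k r_q(⌊M/k⌋)/k ≤ λ_q` (`IntegerScrewWalkTwoLevelsPrep`), Gershgorin for quadratic forms
(`IntegerScrewWalkLevelsAlgebra`).  RH-free.  References: PIVOT-LAW §13.10 (iv), CONTINUUM-LIMIT §23.18
(rh-explicit A6-PIVOT); M. Suzuki, J. Lond. Math. Soc. (2) 108 (2023) 1448–1487 [Suzuki2023].
-/

noncomputable section

set_option linter.dupNamespace false -- D-0017: `Summit.<S>.<S>.…` is the designed namespace

namespace Summit.RiemannHypothesis.RiemannHypothesis.Theorems.IntegerScrew

open Finset ArithmeticFunction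

/-- `|φ_S(k)| ≤ 1` for a finite set `S` of primes (`|φ_p| ≤ 1`). -/
theorem abs_prod_parityFun_le_one (S : Finset ℕ) (hS : ∀ p ∈ S, p.Prime) (k : ℕ) :
    |∏ p ∈ S, parityFun p k| ≤ 1 := by
  rw [Finset.abs_prod]
  refine Finset.prod_le_one (fun p _ => abs_nonneg _) fun p hp => ?_
  have h2 : (2 : ℝ) ≤ p := by exact_mod_cast (hS p hp).two_le
  have hinv : 0 ≤ (p : ℝ)⁻¹ ∧ (p : ℝ)⁻¹ ≤ 1 / 2 := by
    refine ⟨by positivity, ?_⟩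
    rw [inv_eq_one_div]; exact one_div_le_one_div_of_le (by norm_num) h2
  by_cases hd : p ∣ k
  · rw [parityFun_of_dvd hd, abs_le]; constructor <;> linarith [hinv.1, hinv.2]
  · rw [parityFun_of_not_dvd hd, abs_le]; constructor <;> linarith [hinv.1, hinv.2]

/-- **ALL RUNGS.**  Let `𝒮` be a non-empty finite family of non-empty finite sets of primes with
`λ_S = Σ_{p∈S} p log p/(p−1) ≤ Λ`, `Π_{p∈S}p² ≤ m` and `2^{|S ∪ S'|} ≤ B` on `𝒮`, `0 < η ≤ 1`, and
`log M ≥ m·|𝒮|·(Λ+1)(B²+B+1)/η` (`Λ` is `Lam` below).  Then every `g ∈ span{1, φ_S : S ∈ 𝒮}`, `φ_S = Π_{p∈S}φ_p`,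
has `E(g) ≤ ((Λ + η)/log M)·‖g‖²_π`; by min–max for the `π`-self-adjoint `−walkGen M ≥ 0` with simple eigenvalue
`0` (and `walk_rungs_indep`), **`−walkGen M` has at least `|𝒮|` eigenvalues in `(0, (Λ+η)/log M]`** — in `t`-units,
at least `|𝒮|` levels `≤ Λ + η`.  With `𝒮 = {S : λ_S ≤ Λ}` this certifies, from above, every initial segment
`λ_{2} < λ_{3} < λ_{5} < λ_{7} < λ_{11} < λ_{13} < λ_{17} < λ_{2,3} < λ_{19} < …` of the prime-parity ladder
(PIVOT-LAW 13.10 (iv); `λ_{2,3} = λ_2 + λ_3 = 3.034`). -/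
theorem walk_rungs (𝒮 : Finset (Finset ℕ)) (hS : ∀ S ∈ 𝒮, ∀ p ∈ S, p.Prime) (hSne : ∀ S ∈ 𝒮, S.Nonempty)
    (h𝒮 : 𝒮.Nonempty) {Lam η m B : ℝ}
    (hLam : ∀ S ∈ 𝒮, ∑ r ∈ S, (r : ℝ) * Real.log r / ((r : ℝ) - 1) ≤ Lam)
    (hm : ∀ S ∈ 𝒮, ∏ p ∈ S, (p : ℝ) ^ 2 ≤ m)
    (hB : ∀ S ∈ 𝒮, ∀ S' ∈ 𝒮, (2 : ℝ) ^ (S ∪ S').card ≤ B)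
    (hη : 0 < η) (hη1 : η ≤ 1) {M : ℕ}
    (hM : m * 𝒮.card * (Lam + 1) * (B ^ 2 + B + 1) / η ≤ Real.log M)
    (a : Finset ℕ → ℝ) (c : ℝ) :
    -(∑ k : St M, (∑ S ∈ 𝒮, a S * ∏ p ∈ S, parityFun p k + c) / (k : ℕ) *
        ∑ j : St M, walkGen M k j * (∑ S ∈ 𝒮, a S * ∏ p ∈ S, parityFun p j + c)) ≤
      ((Lam + η) / Real.log M) * ∑ k : St M, (∑ S ∈ 𝒮, a S * ∏ p ∈ S, parityFun p k + c) ^ 2 / (k : ℕ) := by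
  classical
  -- basic sizes
  obtain ⟨S₀, hS₀⟩ := h𝒮
  have hlamr_nonneg : ∀ S ∈ 𝒮, ∀ r ∈ S, 0 ≤ (r : ℝ) * Real.log r / ((r : ℝ) - 1) := by
    intro S hSS r hr
    have h2 : (2 : ℝ) ≤ r := by exact_mod_cast (hS S hSS r hr).two_le
    exact div_nonneg (mul_nonneg (by linarith) (Real.log_nonneg (by linarith))) (by linarith)
  have hlam_nonneg : ∀ S ∈ 𝒮, 0 ≤ ∑ r ∈ S, (r : ℝ) * Real.log r / ((r : ℝ) - 1) :=
    fun S hSS => Finset.sum_nonneg fun r hr => hlamr_nonneg S hSS r hr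
  have hLam0 : 0 ≤ Lam := (hlam_nonneg S₀ hS₀).trans (hLam S₀ hS₀)
  have hcard : (1 : ℝ) ≤ 𝒮.card := by exact_mod_cast Finset.card_pos.2 ⟨S₀, hS₀⟩
  have hprod1 : ∀ S ∈ 𝒮, (1 : ℝ) ≤ ∏ p ∈ S, (p : ℝ) ^ 2 := by
    intro S hSS
    rw [← Finset.prod_const_one (s := S)]
    refine Finset.prod_le_prod (fun p _ => zero_le_one) fun p hp => ?_
    have h2 : (2 : ℝ) ≤ p := by exact_mod_cast (hS S hSS p hp).two_le
    nlinarith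
  have hm1 : 1 ≤ m := (hprod1 S₀ hS₀).trans (hm S₀ hS₀)
  have hB2 : 2 ≤ B := by
    have h := hB S₀ hS₀ S₀ hS₀
    rw [Finset.union_idempotent] at h
    have hc : 1 ≤ S₀.card := Finset.card_pos.2 (hSne S₀ hS₀)
    have : (2 : ℝ) ≤ 2 ^ S₀.card := by
      calc (2 : ℝ) = 2 ^ 1 := by norm_num
        _ ≤ 2 ^ S₀.card := pow_le_pow_right₀ (by norm_num) hc
    linarith
  set T : ℝ := m * 𝒮.card * (Lam + 1) * (B ^ 2 + B + 1) / η with hT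
  have hTη : m * 𝒮.card * (Lam + 1) * (B ^ 2 + B + 1) = T * η := by rw [hT]; field_simp
  have hT7 : 7 ≤ T := by
    rw [hT, le_div_iff₀ hη]
    have h1 : (1 : ℝ) * 1 ≤ m * 𝒮.card := mul_le_mul hm1 hcard (by norm_num) (by linarith)
    have h2 : (1 : ℝ) * 1 * 1 ≤ m * 𝒮.card * (Lam + 1) := mul_le_mul h1 (by linarith) (by norm_num) (by nlinarith)
    have h3 : (7 : ℝ) ≤ B ^ 2 + B + 1 := by nlinarith
    have h4 : 1 * 1 * 1 * (7 : ℝ) ≤ m * 𝒮.card * (Lam + 1) * (B ^ 2 + B + 1) :=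
      mul_le_mul h2 h3 (by norm_num) (by nlinarith)
    nlinarith
  have hL7 : 7 ≤ Real.log M := hT7.trans hM
  have hM1 : 1 ≤ M := by
    by_contra h0
    have : M = 0 := by omega
    rw [this] at hL7; simp at hL7; linarith
  have hM0 : (0 : ℝ) < M := by exact_mod_cast hM1
  set L := Real.log M with hLdef
  have hL : 0 < L := by linarith only [hL7]
  -- notation
  set φ : Finset ℕ → St M → ℝ := fun S k => ∏ p ∈ S, parityFun p k with hφ
  set D : ℕ → St M → ℝ := fun r k => if r ∣ (k : ℕ) then 0 else
    (Real.log r / ((r : ℝ) - 1) - ∑ n ∈ (Icc 1 (M / k)).filter (fun n => r ∣ n), (Λ n : ℝ) / n) with hD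
  set E : Finset ℕ → St M → ℝ := fun S k => ∑ r ∈ S, (∏ p ∈ S.erase r, parityFun p k) * D r k with hE
  set lam : Finset ℕ → ℝ := fun S => ∑ r ∈ S, (r : ℝ) * Real.log r / ((r : ℝ) - 1) with hlam
  set H : ℝ := ∑ k : St M, (1 : ℝ) / (k : ℕ) with hHdef
  set N : Finset ℕ → Finset ℕ → ℝ := fun S S' => ∑ k : St M, φ S k * φ S' k / (k : ℕ) with hN
  set R : Finset ℕ → Finset ℕ → ℝ := fun S S' => ∑ k : St M, φ S k * E S' k / (k : ℕ) with hR
  set Sm : Finset ℕ → ℝ := fun S => ∑ k : St M, φ S k / (k : ℕ) with hSm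
  show -(∑ k : St M, (∑ S ∈ 𝒮, a S * φ S k + c) / (k : ℕ) *
      ∑ j : St M, walkGen M k j * (∑ S ∈ 𝒮, a S * φ S j + c)) ≤
    ((Lam + η) / L) * ∑ k : St M, (∑ S ∈ 𝒮, a S * φ S k + c) ^ 2 / (k : ℕ)
  clear_value L φ D E lam H N R Sm
  -- the harmonic number
  have hHI : ∑ i ∈ Icc 1 M, (1 : ℝ) / i = H := by
    rw [hHdef, Finset.sum_coe_sort (Finset.Icc 1 M) (fun k => (1 : ℝ) / k)]
  have hTH : T ≤ H := by
    have h := log_succ_le_harmonicSum M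
    rw [hHI] at h
    have hM' := hM
    rw [hLdef] at hM'
    exact hM'.trans ((Real.log_le_log hM0 (by linarith only [hM0])).trans h)
  have hH7 : 7 ≤ H := hT7.trans hTH
  have hH0 : 0 < H := by linarith only [hH7]
  have hH1 : 1 ≤ H := by linarith only [hH7]
  -- λ
  have hlamv : ∀ S, lam S = ∑ r ∈ S, (r : ℝ) * Real.log r / ((r : ℝ) - 1) := fun S => by rw [hlam]
  have hlamΛ : ∀ S ∈ 𝒮, lam S ≤ Lam := fun S h => by rw [hlamv]; exact hLam S h
  have hlam0 : ∀ S ∈ 𝒮, 0 ≤ lam S := fun S h => by rw [hlamv]; exact hlam_nonneg S h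
  -- φ facts
  have hφv : ∀ S (k : St M), φ S k = ∏ p ∈ S, parityFun p k := fun S k => by rw [hφ]
  have hφabs : ∀ S ∈ 𝒮, ∀ k : St M, |φ S k| ≤ 1 := fun S h k => by rw [hφv]; exact abs_prod_parityFun_le_one S (hS S h) k
  -- D facts
  have hDv : ∀ r (k : St M), D r k = if r ∣ (k : ℕ) then 0 else
      (Real.log r / ((r : ℝ) - 1) - ∑ n ∈ (Icc 1 (M / k)).filter (fun n => r ∣ n), (Λ n : ℝ) / n) :=
    fun r k => by rw [hD]
  have hDb : ∀ S ∈ 𝒮, ∀ r ∈ S, ∀ k : St M, 0 ≤ D r k ∧ D r k ≤ Real.log r / ((r : ℝ) - 1) -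
      ∑ n ∈ (Icc 1 (M / k)).filter (fun n => r ∣ n), (Λ n : ℝ) / n := by
    intro S hSS r hr k
    have hnn := parityDefect_nonneg (hS S hSS r hr) (M / k)
    rw [hDv]
    by_cases hd : r ∣ (k : ℕ)
    · rw [if_pos hd]; exact ⟨le_rfl, hnn⟩
    · rw [if_neg hd]; exact ⟨hnn, le_rfl⟩
  have hsumD : ∀ S ∈ 𝒮, ∀ r ∈ S, ∑ k : St M, D r k / (k : ℕ) ≤ (r : ℝ) * Real.log r / ((r : ℝ) - 1) := by
    intro S hSS r hr
    have h := sum_parityDefect_div_le (hS S hSS r hr) hM1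
    rw [← Finset.sum_coe_sort (Finset.Icc 1 M)] at h
    exact le_trans (Finset.sum_le_sum fun k _ =>
      div_le_div_of_nonneg_right (hDb S hSS r hr k).2 (Nat.cast_nonneg _)) h
  -- E facts: |E_S(k)| ≤ Σ_{r∈S} D_r(k), and φ_S(k)E_S(k) ≥ 0
  have hEv : ∀ S (k : St M), E S k = ∑ r ∈ S, (∏ p ∈ S.erase r, parityFun p k) * D r k := fun S k => by rw [hE]
  have hEabs : ∀ S ∈ 𝒮, ∀ k : St M, |E S k| ≤ ∑ r ∈ S, D r k := by
    intro S hSS k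
    rw [hEv]
    refine (Finset.abs_sum_le_sum_abs _ _).trans (Finset.sum_le_sum fun r hr => ?_)
    rw [abs_mul, abs_of_nonneg (hDb S hSS r hr k).1]
    calc |∏ p ∈ S.erase r, parityFun p (k : ℕ)| * D r k ≤ 1 * D r k :=
          mul_le_mul_of_nonneg_right (abs_prod_parityFun_le_one _ (fun p hp => hS S hSS p (Finset.mem_of_mem_erase hp)) _)
            (hDb S hSS r hr k).1
      _ = D r k := one_mul _
  have hφE_nonneg : ∀ S ∈ 𝒮, ∀ k : St M, 0 ≤ φ S k * E S k := by
    intro S hSS k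
    rw [hφv, hEv, Finset.mul_sum]
    refine Finset.sum_nonneg fun r hr => ?_
    rw [← Finset.prod_erase_mul S (fun p => parityFun p (k : ℕ)) hr]
    have h0 := (hDb S hSS r hr k).1
    by_cases hd : r ∣ (k : ℕ)
    · have hz : D r k = 0 := by rw [hDv, if_pos hd]
      rw [hz]; simp
    · have hφr : 0 ≤ parityFun r (k : ℕ) := by rw [parityFun_of_not_dvd hd]; positivity
      have e : (∏ p ∈ S.erase r, parityFun p (k : ℕ)) * parityFun r k * ((∏ p ∈ S.erase r, parityFun p (k : ℕ)) * D r k) =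
          (∏ p ∈ S.erase r, parityFun p (k : ℕ)) ^ 2 * (parityFun r k * D r k) := by ring
      rw [e]
      exact mul_nonneg (sq_nonneg _) (mul_nonneg hφr h0)
  -- Gram / defect entries
  have hNv : ∀ S S', N S S' = ∑ k : St M, φ S k * φ S' k / (k : ℕ) := fun S S' => by rw [hN]
  have hRv : ∀ S S', R S S' = ∑ k : St M, φ S k * E S' k / (k : ℕ) := fun S S' => by rw [hR]
  have hSmv : ∀ S, Sm S = ∑ k : St M, φ S k / (k : ℕ) := fun S => by rw [hSm]
  have hNSS : ∀ S ∈ 𝒮, H / m ≤ N S S := by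
    intro S hSS
    have h1 : H / ∏ p ∈ S, (p : ℝ) ^ 2 ≤ N S S := by
      rw [hNv, ← hHI]
      have e : ∑ k : St M, φ S k * φ S k / ((k : ℕ) : ℝ) =
          ∑ k ∈ Icc 1 M, (∏ p ∈ S, parityFun p k) * (∏ p ∈ S, parityFun p k) / (k : ℝ) := by
        rw [← Finset.sum_coe_sort (Finset.Icc 1 M)
          (fun k : ℕ => (∏ p ∈ S, parityFun p k) * (∏ p ∈ S, parityFun p k) / (k : ℝ))]
        exact Finset.sum_congr rfl fun k _ => by rw [hφv]
      rw [e]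
      exact sum_prod_parityFun_sq_div_ge S (hS S hSS) M
    have h3 : H / m ≤ H / ∏ p ∈ S, (p : ℝ) ^ 2 :=
      div_le_div_of_nonneg_left hH0.le (by linarith [hprod1 S hSS]) (hm S hSS)
    exact h3.trans h1
  have hNSS' : ∀ S ∈ 𝒮, ∀ S' ∈ 𝒮, S ≠ S' → |N S S'| ≤ B := by
    intro S hSS S' hSS' hne
    have e : N S S' = ∑ k ∈ Icc 1 M, (∏ p ∈ S, parityFun p k) * (∏ p ∈ S', parityFun p k) / (k : ℝ) := by
      rw [hNv, ← Finset.sum_coe_sort (Finset.Icc 1 M)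
        (fun k : ℕ => (∏ p ∈ S, parityFun p k) * (∏ p ∈ S', parityFun p k) / (k : ℝ))]
      exact Finset.sum_congr rfl fun k _ => by rw [hφv, hφv]
    rw [e]
    exact (abs_sum_prod_parityFun_mul_div_le S S' (hS S hSS) (hS S' hSS') hne M).trans (hB S hSS S' hSS')
  have hSmB : ∀ S ∈ 𝒮, Sm S ^ 2 ≤ B ^ 2 := by
    intro S hSS
    have e : Sm S = ∑ k ∈ Icc 1 M, (∏ p ∈ S, parityFun p k) / (k : ℝ) := by
      rw [hSmv, ← Finset.sum_coe_sort (Finset.Icc 1 M) (fun k : ℕ => (∏ p ∈ S, parityFun p k) / (k : ℝ))]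
      exact Finset.sum_congr rfl fun k _ => by rw [hφv]
    have h1 : |Sm S| ≤ B := by
      rw [e]
      refine (abs_sum_prod_parityFun_div_le S (hS S hSS) (hSne S hSS) M).trans ?_
      have h := hB S hSS S hSS
      rwa [Finset.union_idempotent] at h
    have h2 : 0 ≤ |Sm S| := abs_nonneg _
    calc Sm S ^ 2 = |Sm S| ^ 2 := (sq_abs _).symm
      _ ≤ B ^ 2 := pow_le_pow_left₀ h2 h1 2
  have hRSS : ∀ S ∈ 𝒮, 0 ≤ R S S := by
    intro S hSS
    rw [hRv]
    exact Finset.sum_nonneg fun k _ => div_nonneg (hφE_nonneg S hSS k) (Nat.cast_nonneg _)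
  have hRSS' : ∀ S ∈ 𝒮, ∀ S' ∈ 𝒮, |R S S'| ≤ lam S' := by
    intro S hSS S' hSS'
    rw [hRv, hlamv]
    refine (Finset.abs_sum_le_sum_abs _ _).trans ?_
    calc ∑ k : St M, |φ S k * E S' k / ((k : ℕ) : ℝ)| ≤ ∑ k : St M, ∑ r ∈ S', D r k / (k : ℕ) := by
          refine Finset.sum_le_sum fun k _ => ?_
          rw [abs_div, abs_mul, Nat.abs_cast, ← Finset.sum_div]
          refine div_le_div_of_nonneg_right ?_ (Nat.cast_nonneg _)
          calc |φ S k| * |E S' k| ≤ 1 * ∑ r ∈ S', D r k :=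
                mul_le_mul (hφabs S hSS k) (hEabs S' hSS' k) (abs_nonneg _) zero_le_one
            _ = ∑ r ∈ S', D r k := one_mul _
      _ = ∑ r ∈ S', ∑ k : St M, D r k / (k : ℕ) := Finset.sum_comm
      _ ≤ ∑ r ∈ S', (r : ℝ) * Real.log r / ((r : ℝ) - 1) := Finset.sum_le_sum fun r hr => hsumD S' hSS' r hr
  -- the Gershgorin matrix
  set K : ℝ := (Lam + η) * (𝒮.card * B ^ 2) / H with hK
  set Bm : Finset ℕ → Finset ℕ → ℝ := fun S S' => (Lam + η - lam S') * N S S' + R S S' -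
    (if S = S' then K else 0) with hBm
  have hBmv : ∀ S S', Bm S S' = (Lam + η - lam S') * N S S' + R S S' - (if S = S' then K else 0) :=
    fun S S' => by rw [hBm]
  clear_value Bm
  have hcB : 0 ≤ (𝒮.card : ℝ) * B ^ 2 := mul_nonneg (Nat.cast_nonneg _) (sq_nonneg B)
  have hK0 : 0 ≤ K := by rw [hK]; exact div_nonneg (mul_nonneg (by linarith) hcB) hH0.le
  have hKle : K ≤ (Lam + 1) * (𝒮.card * B ^ 2) := by
    rw [hK, div_le_iff₀ hH0]
    have h5 : (Lam + η) * (𝒮.card * B ^ 2) ≤ (Lam + 1) * (𝒮.card * B ^ 2) :=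
      mul_le_mul_of_nonneg_right (by linarith) hcB
    have hpos : 0 ≤ (Lam + 1) * (𝒮.card * B ^ 2) := mul_nonneg (by linarith) hcB
    have h6 : (Lam + 1) * (𝒮.card * B ^ 2) * 1 ≤ (Lam + 1) * (𝒮.card * B ^ 2) * H :=
      mul_le_mul_of_nonneg_left hH1 hpos
    linarith
  have hBoff : ∀ S ∈ 𝒮, ∀ S' ∈ 𝒮, S ≠ S' → |Bm S S'| ≤ (Lam + 1) * (B + 1) := by
    intro S hSS S' hSS' hne
    rw [hBmv, if_neg hne, sub_zero]
    have h1 : |(Lam + η - lam S') * N S S'| ≤ (Lam + 1) * B := by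
      rw [abs_mul, abs_of_nonneg (by linarith [hlamΛ S' hSS'])]
      exact mul_le_mul (by linarith [hlam0 S' hSS']) (hNSS' S hSS S' hSS' hne) (abs_nonneg _) (by linarith)
    have h2 : |R S S'| ≤ Lam := (hRSS' S hSS S' hSS').trans (hlamΛ S' hSS')
    have h3 : Lam ≤ (Lam + 1) * 1 := by linarith
    calc |(Lam + η - lam S') * N S S' + R S S'| ≤ (Lam + 1) * B + Lam := (abs_add_le _ _).trans (by linarith)
      _ ≤ (Lam + 1) * (B + 1) := by nlinarith
  have hBdiag : ∀ S ∈ 𝒮, 𝒮.card * ((Lam + 1) * (B + 1)) ≤ Bm S S := by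
    intro S hSS
    rw [hBmv, if_pos rfl]
    have h1 : η * (H / m) ≤ (Lam + η - lam S) * N S S :=
      mul_le_mul (by linarith [hlamΛ S hSS]) (hNSS S hSS) (div_nonneg hH0.le (by linarith)) (by linarith [hlamΛ S hSS])
    -- η H/m ≥ |𝒮|(Λ+1)(B²+B+1) from H ≥ T
    have h3 : (𝒮.card : ℝ) * ((Lam + 1) * (B ^ 2 + B + 1)) ≤ η * (H / m) := by
      have hm0 : (0 : ℝ) < m := by linarith
      rw [mul_div_assoc', le_div_iff₀ hm0]
      calc (𝒮.card : ℝ) * ((Lam + 1) * (B ^ 2 + B + 1)) * m = T * η := by rw [← hTη]; ring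
        _ ≤ H * η := mul_le_mul_of_nonneg_right hTH hη.le
        _ = η * H := mul_comm _ _
    have h4 : (𝒮.card : ℝ) * ((Lam + 1) * (B ^ 2 + B + 1)) =
        𝒮.card * ((Lam + 1) * (B + 1)) + (Lam + 1) * (𝒮.card * B ^ 2) := by ring
    linarith [hRSS S hSS]
  have hG : ∀ S ∈ 𝒮, ∑ S' ∈ 𝒮, (if S = S' then (0 : ℝ) else (|Bm S S'| + |Bm S' S|) / 2) ≤ Bm S S := by
    intro S hSS
    have h1 : ∑ S' ∈ 𝒮, (if S = S' then (0 : ℝ) else (|Bm S S'| + |Bm S' S|) / 2) ≤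
        ∑ S' ∈ 𝒮, (Lam + 1) * (B + 1) := by
      refine Finset.sum_le_sum fun S' hSS' => ?_
      have hnn : 0 ≤ (Lam + 1) * (B + 1) := mul_nonneg (by linarith) (by linarith)
      by_cases h : S = S'
      · rw [if_pos h]; exact hnn
      · rw [if_neg h]
        have ha := hBoff S hSS S' hSS' h
        have hb := hBoff S' hSS' S hSS (Ne.symm h)
        linarith
    rw [Finset.sum_const, nsmul_eq_mul] at h1
    exact h1.trans (hBdiag S hSS)
  have hform := form_nonneg_of_diag_dominant 𝒮 Bm a hG
  -- rows of the generator (exact eigen-relations for φ_S), and the generator on g₀ = Σ a_S φ_S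
  have hrow : ∀ S ∈ 𝒮, ∀ k : St M, ∑ j : St M, walkGen M k j * φ S j = -(lam S / L) * φ S k + (1 / L) * E S k := by
    intro S hSS k
    have h := walkGen_parity_prod_eq S (hS S hSS) k
    have e1 : (fun j : St M => walkGen M k j * φ S j) = fun j => walkGen M k j * ∏ p ∈ S, parityFun p j := by
      funext j; rw [hφv]
    rw [show (∑ j : St M, walkGen M k j * φ S j) = ∑ j : St M, walkGen M k j * ∏ p ∈ S, parityFun p j from
      by rw [e1], hφv, hEv, hlamv, hLdef]
    rw [h]
    simp only [hDv]
  have hGg : ∀ k : St M, ∑ j : St M, walkGen M k j * (∑ S ∈ 𝒮, a S * φ S j) =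
      ∑ S ∈ 𝒮, a S * (-(lam S / L) * φ S k + (1 / L) * E S k) := by
    intro k
    rw [Finset.sum_congr rfl fun j _ => Finset.mul_sum _ _ _, Finset.sum_comm]
    refine Finset.sum_congr rfl fun S hSS => ?_
    rw [← hrow S hSS k, Finset.mul_sum]
    exact Finset.sum_congr rfl fun j _ => by ring
  -- Q and the norm in closed form
  have hshift := dirichlet_add_const M (fun k => ∑ S ∈ 𝒮, a S * φ S k) c
  have hQ : ∑ k : St M, (∑ S ∈ 𝒮, a S * φ S k) / (k : ℕ) * ∑ j : St M, walkGen M k j * (∑ S ∈ 𝒮, a S * φ S j) =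
      ∑ S ∈ 𝒮, ∑ S' ∈ 𝒮, a S * a S' * (-(lam S' / L) * N S S' + (1 / L) * R S S') := by
    rw [Finset.sum_congr rfl fun k _ => by rw [hGg k]]
    rw [sum_bilinear_expand 𝒮 a φ (fun S' k => -(lam S' / L) * φ S' k + (1 / L) * E S' k)]
    refine Finset.sum_congr rfl fun S _ => Finset.sum_congr rfl fun S' _ => ?_
    congr 1
    rw [hNv, hRv, Finset.mul_sum, Finset.mul_sum, ← Finset.sum_add_distrib]
    exact Finset.sum_congr rfl fun k _ => by ring
  have hnorm : ∑ k : St M, (∑ S ∈ 𝒮, a S * φ S k + c) ^ 2 / ((k : ℕ) : ℝ) =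
      ∑ S ∈ 𝒮, ∑ S' ∈ 𝒮, a S * a S' * N S S' + 2 * c * ∑ S ∈ 𝒮, a S * Sm S + c ^ 2 * H := by
    rw [sum_norm_expand]
    simp only [hNv, hSmv, hHdef]
  -- lower bound for the norm
  have hnorm_lb : ∑ S ∈ 𝒮, ∑ S' ∈ 𝒮, a S * a S' * N S S' - 𝒮.card * B ^ 2 * (∑ S ∈ 𝒮, a S ^ 2) / H ≤
      ∑ S ∈ 𝒮, ∑ S' ∈ 𝒮, a S * a S' * N S S' + 2 * c * ∑ S ∈ 𝒮, a S * Sm S + c ^ 2 * H := by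
    set U : ℝ := ∑ S ∈ 𝒮, a S * Sm S with hU
    have hCS : U ^ 2 ≤ (∑ S ∈ 𝒮, a S ^ 2) * ∑ S ∈ 𝒮, Sm S ^ 2 := by
      rw [hU]; exact Finset.sum_mul_sq_le_sq_mul_sq 𝒮 a Sm
    have hS2 : ∑ S ∈ 𝒮, Sm S ^ 2 ≤ 𝒮.card * B ^ 2 := by
      have := Finset.sum_le_sum fun S hSS => hSmB S hSS
      rwa [Finset.sum_const, nsmul_eq_mul] at this
    have hU2 : U ^ 2 ≤ 𝒮.card * B ^ 2 * ∑ S ∈ 𝒮, a S ^ 2 := by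
      have := mul_le_mul_of_nonneg_left hS2 (Finset.sum_nonneg fun S (_ : S ∈ 𝒮) => sq_nonneg (a S))
      linarith
    have hc : -(U ^ 2) / H ≤ 2 * c * U + c ^ 2 * H := by
      rw [div_le_iff₀ hH0]
      have e : (2 * c * U + c ^ 2 * H) * H = (c * H + U) ^ 2 - U ^ 2 := by ring
      rw [e]
      linarith only [sq_nonneg (c * H + U)]
    have h4 : U ^ 2 / H ≤ 𝒮.card * B ^ 2 * (∑ S ∈ 𝒮, a S ^ 2) / H := div_le_div_of_nonneg_right hU2 hH0.le
    rw [neg_div] at hc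
    linarith only [hc, h4]
  -- the Gershgorin form, expanded
  have hBsum : ∑ S ∈ 𝒮, ∑ S' ∈ 𝒮, a S * a S' * Bm S S' =
      (Lam + η) * (∑ S ∈ 𝒮, ∑ S' ∈ 𝒮, a S * a S' * N S S' - 𝒮.card * B ^ 2 * (∑ S ∈ 𝒮, a S ^ 2) / H) -
        ∑ S ∈ 𝒮, ∑ S' ∈ 𝒮, a S * a S' * (lam S' * N S S' - R S S') := by
    have e : ∀ S ∈ 𝒮, ∀ S' ∈ 𝒮, a S * a S' * Bm S S' =
        (Lam + η) * (a S * a S' * N S S') - a S * a S' * (lam S' * N S S' - R S S') -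
          (if S = S' then K * a S ^ 2 else 0) := by
      intro S _ S' _
      rw [hBmv]
      by_cases h : S = S'
      · subst h; rw [if_pos rfl, if_pos rfl]; ring
      · rw [if_neg h, if_neg h]; ring
    rw [Finset.sum_congr rfl fun S hSS => Finset.sum_congr rfl fun S' hSS' => e S hSS S' hSS']
    simp only [Finset.sum_sub_distrib]
    have h1 : ∑ S ∈ 𝒮, ∑ S' ∈ 𝒮, (Lam + η) * (a S * a S' * N S S') =
        (Lam + η) * ∑ S ∈ 𝒮, ∑ S' ∈ 𝒮, a S * a S' * N S S' := by
      rw [Finset.mul_sum]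
      exact Finset.sum_congr rfl fun S _ => by rw [Finset.mul_sum]
    have h3 : ∑ S ∈ 𝒮, ∑ S' ∈ 𝒮, (if S = S' then K * a S ^ 2 else 0) = K * ∑ S ∈ 𝒮, a S ^ 2 := by
      rw [Finset.mul_sum]
      exact Finset.sum_congr rfl fun S hSS => by rw [Finset.sum_ite_eq, if_pos hSS]
    rw [h1, h3, hK]
    have hHne : H ≠ 0 := hH0.ne'
    field_simp
    ring
  -- assemble
  have hΛη : 0 ≤ Lam + η := by linarith
  have hfin : ∑ S ∈ 𝒮, ∑ S' ∈ 𝒮, a S * a S' * (lam S' * N S S' - R S S') ≤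
      (Lam + η) * (∑ S ∈ 𝒮, ∑ S' ∈ 𝒮, a S * a S' * N S S' + 2 * c * ∑ S ∈ 𝒮, a S * Sm S + c ^ 2 * H) := by
    have h1 : ∑ S ∈ 𝒮, ∑ S' ∈ 𝒮, a S * a S' * (lam S' * N S S' - R S S') ≤
        (Lam + η) * (∑ S ∈ 𝒮, ∑ S' ∈ 𝒮, a S * a S' * N S S' - 𝒮.card * B ^ 2 * (∑ S ∈ 𝒮, a S ^ 2) / H) := by
      linarith only [hform, hBsum]
    exact h1.trans (mul_le_mul_of_nonneg_left hnorm_lb hΛη)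
  rw [hshift, hQ, hnorm]
  have e1 : -(∑ S ∈ 𝒮, ∑ S' ∈ 𝒮, a S * a S' * (-(lam S' / L) * N S S' + (1 / L) * R S S')) =
      (∑ S ∈ 𝒮, ∑ S' ∈ 𝒮, a S * a S' * (lam S' * N S S' - R S S')) / L := by
    rw [Finset.sum_div, ← Finset.sum_neg_distrib]
    refine Finset.sum_congr rfl fun S _ => ?_
    rw [Finset.sum_div, ← Finset.sum_neg_distrib]
    refine Finset.sum_congr rfl fun S' _ => ?_
    field_simp
    ring
  have e2 : (Lam + η) / L * (∑ S ∈ 𝒮, ∑ S' ∈ 𝒮, a S * a S' * N S S' + 2 * c * ∑ S ∈ 𝒮, a S * Sm S + c ^ 2 * H) =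
      ((Lam + η) * (∑ S ∈ 𝒮, ∑ S' ∈ 𝒮, a S * a S' * N S S' + 2 * c * ∑ S ∈ 𝒮, a S * Sm S + c ^ 2 * H)) / L := by
    ring
  rw [e1, e2]
  exact div_le_div_of_nonneg_right hfin hL.le

end Summit.RiemannHypothesis.RiemannHypothesis.Theorems.IntegerScrew

end
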